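import Summits.AtomisticToContinuum.Crystallization.Theorems.PalmUnimodularRigidityLayeredLawsSelectHcpDefs
import Summits.AtomisticToContinuum.Crystallization.Theorems.LayeredLawsSelectHcp.Negative.RootedRedundant
import Summits.AtomisticToContinuum.Crystallization.Theorems.PalmUnimodularRigidityMinimiserShellsEnergyFloorC

/-!
# Crux `LayeredLawsSelectHcp` (stmt-AtomisticToContinuum-9226), line `mtp-prestress-split-ergodic-frame`:
# the mean root energy of a layered point-stationary law is an honest expectation

Registered sub-goal `tube_rootEnergy_integrable` of the crux item (plumbing every proof of the energy-floor
stub `stub_tubeEnergyFloor` starts with): for a point-stationary LAYERED probability law `P` the root energy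
`h(μ) = ½ ∫ V_LJ(‖y‖) dμ` is `P`-INTEGRABLE, so that `meanRootEnergy P = E_P[h]` is a genuine expectation (no
Bochner junk) and can be manipulated linearly (splitting into shells, mass transport, averaging).  Proof: layered
laws are a.s. rooted `891/1000`-hard-core configurations (`rooted_of_pointStationary_layered`); on those `h`
agrees with the Giry-measurable `rootEnergy'` of the sibling `MinimiserShells` energy-floor line and is bounded by
`250/12·δ⁻⁶ + 250/24·δ⁻¹²` (`rootEnergy'_eq_of_hc`, `rootEnergy'_bounds_of_hc`), whence a.e.-strong
measurability and integrability on a probability space.  Also recorded: the two-sided a priori bound on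
`meanRootEnergy P`.  [folklore]
-/

noncomputable section

open MeasureTheory
open scoped ENNReal

namespace Summit.AtomisticToContinuum.Crystallization.Theorems.PalmUnimodularRigidity.LayeredLawsSelectHcp

open Literature.Probability.Process (IsRootedHardCore)
open Literature.MathematicalPhysics.StatisticalMechanics (lennardJones)
open Summit.AtomisticToContinuum.Crystallization.Theorems.LayeredLawsSelectHcp.Negative.DiracLaws
  (PointStationary meanRootEnergy Layered)
open Summit.AtomisticToContinuum.Crystallization.Theorems.LayeredLawsSelectHcp.Negative.RootedRedundant
  (rooted_of_pointStationary_layered)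
open Summit.AtomisticToContinuum.Crystallization.Theorems.PalmUnimodularRigidityMinimiserShells.EnergyFloor
  (rootEnergy' measurable_rootEnergy' rootEnergy'_eq_of_hc rootEnergy'_bounds_of_hc)

/-- Euclidean `3`-space. [folklore] -/
local notation "E3" => EuclideanSpace ℝ (Fin 3)

/-- On the a.e. class of a layered law the root energy IS `rootEnergy'` and is bounded. [folklore] -/
theorem ae_rootEnergy_eq_and_bound {P : Measure (Measure E3)} (h2 : PointStationary P) (h4 : Layered P) :
    ∀ᵐ μ ∂P, (∫ y, lennardJones ‖y‖ ∂μ) / 2 = rootEnergy' μ ∧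
      |(∫ y, lennardJones ‖y‖ ∂μ) / 2| ≤
        250 / 12 * (891 / 1000 : ℝ)⁻¹ ^ 6 + 250 / 24 * (891 / 1000 : ℝ)⁻¹ ^ 12 := by
  -- layered laws are a.s. rooted `891/1000`-hard-core configurations (read as `IsRootedHardCore`)
  have hcore : ∀ᵐ μ ∂P, IsRootedHardCore (891 / 1000) μ := rooted_of_pointStationary_layered h2 h4
  filter_upwards [hcore] with μ hμ
  have hδ : (0 : ℝ) < 891 / 1000 := by norm_num
  have heq := rootEnergy'_eq_of_hc hδ hμ
  have hb := rootEnergy'_bounds_of_hc hδ hμ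
  refine ⟨heq.symm, ?_⟩
  rw [← heq, abs_le]
  have h6 : (0 : ℝ) ≤ 250 / 12 * (891 / 1000 : ℝ)⁻¹ ^ 6 := by positivity
  have h12 : (0 : ℝ) ≤ 250 / 24 * (891 / 1000 : ℝ)⁻¹ ^ 12 := by positivity
  constructor <;> linarith [hb.1, hb.2]

/-- **Registered sub-goal `tube_rootEnergy_integrable`.**  For a point-stationary layered probability law the
root energy `μ ↦ ½∫ V_LJ(‖y‖) dμ` is `P`-integrable (a.e. equal to the Giry-measurable `rootEnergy'`, bounded by
`250/12 · (891/1000)⁻⁶ + 250/24 · (891/1000)⁻¹²` on the hard-core class). [folklore] -/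
theorem tube_rootEnergy_integrable :
    ∀ P : Measure (Measure E3), IsProbabilityMeasure P → PointStationary P → Layered P →
      Integrable (fun μ : Measure E3 => (∫ y, lennardJones ‖y‖ ∂μ) / 2) P := by
  intro P hP h2 h4
  have hae := ae_rootEnergy_eq_and_bound h2 h4
  have hmeas : AEStronglyMeasurable (fun μ : Measure E3 => (∫ y, lennardJones ‖y‖ ∂μ) / 2) P := by
    refine ⟨rootEnergy', measurable_rootEnergy'.stronglyMeasurable, ?_⟩
    filter_upwards [hae] with μ hμ
    exact hμ.1
  refine Integrable.mono'
    (integrable_const (250 / 12 * (891 / 1000 : ℝ)⁻¹ ^ 6 + 250 / 24 * (891 / 1000 : ℝ)⁻¹ ^ 12)) hmeas ?_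
  filter_upwards [hae] with μ hμ
  rw [Real.norm_eq_abs]
  exact hμ.2

/-- Corollary: `meanRootEnergy P = ∫ rootEnergy' dP` and the a priori bound
`|meanRootEnergy P| ≤ 250/12 · (891/1000)⁻⁶ + 250/24 · (891/1000)⁻¹²` for point-stationary layered probability
laws. [folklore] -/
theorem meanRootEnergy_eq_integral_rootEnergy' {P : Measure (Measure E3)} [IsProbabilityMeasure P]
    (h2 : PointStationary P) (h4 : Layered P) :
    meanRootEnergy P = ∫ μ, rootEnergy' μ ∂P ∧
      |meanRootEnergy P| ≤ 250 / 12 * (891 / 1000 : ℝ)⁻¹ ^ 6 + 250 / 24 * (891 / 1000 : ℝ)⁻¹ ^ 12 := by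
  have hae := ae_rootEnergy_eq_and_bound h2 h4
  have heq : meanRootEnergy P = ∫ μ, rootEnergy' μ ∂P :=
    integral_congr_ae (hae.mono fun μ hμ => hμ.1)
  refine ⟨heq, ?_⟩
  have hint := tube_rootEnergy_integrable P inferInstance h2 h4
  have h1 : |meanRootEnergy P| ≤ ∫ μ, |(∫ y, lennardJones ‖y‖ ∂μ) / 2| ∂P := by
    show |∫ μ, (∫ y, lennardJones ‖y‖ ∂μ) / 2 ∂P| ≤ _
    exact abs_integral_le_integral_abs
  refine h1.trans ?_
  calc ∫ μ, |(∫ y, lennardJones ‖y‖ ∂μ) / 2| ∂P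
      ≤ ∫ _μ, (250 / 12 * (891 / 1000 : ℝ)⁻¹ ^ 6 + 250 / 24 * (891 / 1000 : ℝ)⁻¹ ^ 12) ∂P :=
        integral_mono_ae hint.abs (integrable_const _) (hae.mono fun μ hμ => hμ.2)
    _ = 250 / 12 * (891 / 1000 : ℝ)⁻¹ ^ 6 + 250 / 24 * (891 / 1000 : ℝ)⁻¹ ^ 12 := by
        rw [integral_const, smul_eq_mul]; simp

end Summit.AtomisticToContinuum.Crystallization.Theorems.PalmUnimodularRigidity.LayeredLawsSelectHcp

end
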